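import Mathlib
import Summits.Ventures.PercRepro2.CoinTreeCore
import Summits.Ventures.PercRepro2.CoinOrTailAlg
import Summits.Ventures.PercRepro2.CoinOrTailDefs
import Summits.Ventures.PercRepro2.CoinOrTailCore

/-!
# The (2,2)-route OR-tail core with the markers adjacent to the tail — an instantiation check
(blind cell PercRepro2, night-2 g9; NIGHT2-DARC.md §35)

A concrete coin system on `Fin 9` (s = 0, p = 1, r = 2, q = 3, t₂ = 4, a = 5, w = 6, v = 7,
t = 8): the two-route core `s → p → r → a ← t₂ ← q ← s` (six single-arc coins), the entries
`r → v`, `a → v`, `q → w` into the head, the arm `w → v` and `v → t` — eleven coins, all random.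
The two branches `{p, r}`, `{q, t₂}` are out-trees (`TreeCore`, by `decide`), the tail `a` is
entered only by `r → a` (coin 4) and `t₂ → a` (coin 5) (`OrTailCore`, by `decide`), and
`darc_of_orTailTrees` gives row 2′DARC at the arc `a → w` for the markers `r, t₂` and every
probability vector — the kernel target of §33.18 (the 7,287-term certificate) as a one-line
corollary, with no non-degeneracy hypothesis.
-/

namespace Summit.Ventures.PercRepro2.Coin

namespace OrTailExample

open Classical

/-- The eleven coins of the example. -/
def arcsEx : Fin 11 → Finset (Fin 9 × Fin 9)
  | 0 => {(0, 1)}   -- s → p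
  | 1 => {(1, 2)}   -- p → r
  | 2 => {(0, 3)}   -- s → q
  | 3 => {(3, 4)}   -- q → t₂
  | 4 => {(2, 5)}   -- cρ : r → a
  | 5 => {(4, 5)}   -- cτ : t₂ → a
  | 6 => {(2, 7)}   -- r → v (entry from branch 1 into the head)
  | 7 => {(5, 7)}   -- a → v (entry from the tail)
  | 8 => {(3, 6)}   -- q → w (entry from branch 2 into w)
  | 9 => {(6, 7)}   -- arm w → v
  | 10 => {(7, 8)}  -- v → t

/-- The tree coins of branch 1: `c p = 0`, `c r = 1`. -/
def c₁Ex : Fin 9 → Fin 11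
  | 1 => 0
  | 2 => 1
  | _ => 0

/-- The parent map of branch 1: `par p = s`, `par r = p`. -/
def par₁Ex : Fin 9 → Fin 9
  | 1 => 0
  | 2 => 1
  | _ => 0

/-- The rank of branch 1. -/
def rk₁Ex : Fin 9 → ℕ
  | 1 => 1
  | 2 => 2
  | _ => 0

/-- The tree coins of branch 2: `c q = 2`, `c t₂ = 3`. -/
def c₂Ex : Fin 9 → Fin 11
  | 3 => 2
  | 4 => 3
  | _ => 0

/-- The parent map of branch 2: `par q = s`, `par t₂ = q`. -/
def par₂Ex : Fin 9 → Fin 9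
  | 3 => 0
  | 4 => 3
  | _ => 0

/-- The rank of branch 2. -/
def rk₂Ex : Fin 9 → ℕ
  | 3 => 1
  | 4 => 2
  | _ => 0

/-- Every coin is a single arc, so `SameEnds` holds. -/
lemma sameEnds_ex : SameEnds arcsEx := by
  intro e xy hxy x'y' hx'y'
  fin_cases e <;> simp [arcsEx] at hxy hx'y' <;> subst hxy <;> subst hx'y' <;>
    exact ⟨Or.inl rfl, Or.inr rfl⟩

/-- Branch 1 `{p, r}` is an out-tree core of `s`. -/
lemma treeCore₁_ex : TreeCore arcsEx 0 {1, 2} c₁Ex par₁Ex rk₁Ex where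
  tree := by decide
  par_mem := by decide
  rank := by decide
  into_C := by decide
  into_s := by decide
  s_notin := by decide

/-- Branch 2 `{q, t₂}` is an out-tree core of `s`. -/
lemma treeCore₂_ex : TreeCore arcsEx 0 {3, 4} c₂Ex par₂Ex rk₂Ex where
  tree := by decide
  par_mem := by decide
  rank := by decide
  into_C := by decide
  into_s := by decide
  s_notin := by decide

/-- The two branches and the tail `a = 5` (coins `4 : r → a`, `5 : t₂ → a`) form an OR-tail core. -/
lemma orTailCore_ex : OrTailCore arcsEx 0 {1, 2} {3, 4} 2 4 5 4 5 where
  p_mem := by decide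
  q_mem := by decide
  disj := by decide
  s_notin₁ := by decide
  s_notin₂ := by decide
  a_notin₁ := by decide
  a_notin₂ := by decide
  a_ne_s := by decide
  into₁ := by decide
  into₂ := by decide
  into_s := by decide
  into_a := by decide
  arcs_ρ := by decide
  arcs_τ := by decide
  ρτ_ne := by decide

/-- **Row 2′DARC at the arc `a → w` of the (2,2)-route core with the markers `r, t₂` adjacent to
the tail, for every probability vector** — no hypothesis beyond `IsProbVec`. -/
theorem darc_orTail_example {R : Type*} [Field R] [LinearOrder R] [IsStrictOrderedRing R]
    (pr : Fin 11 → R) (hp : IsProbVec pr) :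
    DARC pr arcsEx 0 {8} 2 4 5 6 :=
  darc_of_orTailTrees pr hp sameEnds_ex orTailCore_ex treeCore₁_ex treeCore₂_ex (by decide)
    (by decide) (by decide) (by decide)

end OrTailExample

end Summit.Ventures.PercRepro2.Coin
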